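import Literature.MathematicalPhysics.StatisticalMechanics.NJLTruncatedClustering
import Literature.MathematicalPhysics.StatisticalMechanics.NJLThermodynamicLimit
import HarnessLib

/-!
# Theorem 3.11 of Salmhofer–Seiler with the tree length on `ℤ^ν`, and in the thermodynamic limit
# (Salmhofer–Seiler, CMP 139 (1991), Thm. 3.11 (3.32); Erratum CMP 146 (1992) (1)–(2))

The companion file `NJLTruncatedClustering` proves Theorem 3.11 for the truncated `n`-point
functions `⟨σ^{L_1}; …; σ^{L_n}⟩^T_Λ(m)` of the NJL system in every volume `Λ = (ℤ/Lℤ)^ν`, with the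
decay governed by the tree length `ϑ_Λ` of the observables planted on the torus.  The printed
statement (3.32) reads the tree length "`ϑ(x₁,…,x_n)`, the length of a minimal tree on
`{x₁,…,x_n}`" for points of `ℤ^ν`.  This file supplies the comparison and the printed forms:

* `latLinkSrc`/`latLinkTgt` (the links `(x, x+e_μ)` of `ℤ^ν`), `latTreeLength d S = ϑ_{ℤ^ν}` — the
  least number of links of `ℤ^ν` in a link set joining the supports of the observables;
* `njlTreeLength_le_card_of_isLinking` (projection of a linking link set of `ℤ^ν` to the torus) and
  **`latTreeLength_le_njlTreeLength`** (for `2(R + ϑ_{ℤ^ν}) < L`): a torus link set linking the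
  planted family with fewer links than `ϑ_{ℤ^ν}` would lift, link by link along a path
  (`lift_walk`), into the box `|x|_∞ ≤ R + ϑ_{ℤ^ν}` on which the projection is injective, to a link
  set of `ℤ^ν` joining the original supports (`isLinking_liftLinks`);
* **`njl_truncated_clustering_lat`**, **`njl_nPoint_truncated_clustering`** — Thm. 3.11 with the
  `ℤ^ν` tree length, in every volume `L > 2(R + ϑ)`; the second is the printed single-site form
  `|⟨σ_{x₁}; …; σ_{x_n}⟩^T_Λ(m(w))| ≤ 2^{n²} A(r)^n (|w|/r)^{n + 2ϑ(x₁,…,x_n)}`;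
* `njl_truncated_exponentialClustering_lat` — `∃ κ(m) > 0` (one rate for all `n`) `∃ A(m)`:
  `|⟨…⟩^T_Λ(m)| ≤ 2^{n²} A^{|L|} e^{-κ(m) ϑ}` in every large volume;
* `Ursell.tendsto_ursell` and **`njl_truncated_exponentialClustering_limit`** — the same bound for
  the truncated functions of the thermodynamic limit along any sequence of tori (Thm. 3.8,
  `njl_thermodynamicLimit`), i.e. (3.32)/(1) for the infinite-volume NJL state.

Scope as in the companion files: `β = 0` NJL complex spin system, masses off `i[-√(2ν), √(2ν)]`
(`⊇ 𝒲`); nothing about `β > 0`, the continuum, `SU(N)`, a mass gap or the summit's `QCD` conjunct.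

## References

* M. Salmhofer, E. Seiler, *Proof of chiral symmetry breaking in strongly coupled lattice gauge
  theory*, Commun. Math. Phys. 139 (1991) 395–432: Thm. 3.11 (3.32) p. 407, Remark 3.12.
  [SalmhoferSeiler1991]
* M. Salmhofer, E. Seiler, Erratum, Commun. Math. Phys. 146 (1992) 637–638: (1)–(2).
  [SalmhoferSeiler1992Erratum]
-/

noncomputable section

open Finset Filter Topology

namespace Literature.MathematicalPhysics.StatisticalMechanics

/-! ### Limits of truncated functions -/

namespace Ursell

/-- **Truncated functions pass to the limit**: if all moments of the sub-families converge, so does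
the truncated function (it is a polynomial in the moments). [cite: Haag1996, §II.2.2 (II.2.18)] -/
theorem tendsto_ursell {ι : Type*} [LinearOrder ι] {α : Type*} {l : Filter α}
    {E : α → Finset ι → ℂ} {E₀ : Finset ι → ℂ} {S : Finset ι}
    (h : ∀ A ⊆ S, Tendsto (fun a => E a A) l (𝓝 (E₀ A))) :
    Tendsto (fun a => ursell (E a) S) l (𝓝 (ursell E₀ S)) := by
  revert h
  induction S using Finset.strongInduction with
  | H S ih =>
    intro h
    have hfun : (fun a => ursell (E a) S) =
        fun a => E a S - ∑ A ∈ anchored S, ursell (E a) A * E a (S \ A) := by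
      funext a; rw [ursell_eq]
    rw [hfun, ursell_eq]
    refine (h S Subset.rfl).sub (tendsto_finsetSum _ fun A hA => ?_)
    have hAS := ssubset_of_mem_anchored hA
    exact (ih A hAS fun B hB => h B (hB.trans hAS.1)).mul (h (S \ A) sdiff_subset)

end Ursell

namespace ComplexSpin

open MonomerDimer
open Literature.Probability.LatticeModels (TorusSite Site)
open Literature.Probability.LatticeModels

variable {ν : ℕ}

/-! ### Links of `ℤ^ν` and the tree length on `ℤ^ν` -/

/-- The source `x` of the link `(x, μ) ↦ (x, x + e_μ)` of `ℤ^ν`. [cite: SalmhoferSeiler1991, (2.21)] -/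
def latLinkSrc (b : Site ν × Fin ν) : Site ν := b.1

/-- The target `x + e_μ` of the link `(x, μ)` of `ℤ^ν`. [cite: SalmhoferSeiler1991, (2.21)] -/
def latLinkTgt (b : Site ν × Fin ν) : Site ν := b.1 + Pi.single b.2 1

variable {ι : Type*}

/-- **The tree length `ϑ(L_1, …, L_n)` on `ℤ^ν`**: the least number of nearest-neighbour links of
`ℤ^ν` in a link set joining the supports of the observables `σ^{L_i}`, `i ∈ S` — for single sites
"the length of a minimal tree on `{x₁, …, x_n}`". [cite: SalmhoferSeiler1991, Thm. 3.11 (3.32)] -/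
def latTreeLength (d : ι → Site ν →₀ ℕ) (S : Finset ι) : ℕ :=
  steiner (latLinkSrc (ν := ν)) latLinkTgt d S

/-! ### Projection: `ϑ_Λ ≤ ϑ_{ℤ^ν}` -/

section Projection

variable {L : ℕ}

/-- `proj (x + e_μ) = proj x + e_μ`. [folklore] -/
private theorem proj_add_single (L : ℕ) (x : Site ν) (μ : Fin ν) :
    Torus.proj L (x + Pi.single μ 1) = Torus.proj L x + Pi.single μ 1 := by
  funext i
  simp only [Torus.proj_apply, Pi.add_apply, Int.cast_add]
  congr 1
  by_cases h : i = μ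
  · subst h; simp
  · simp [Pi.single_eq_of_ne h]

/-- A planted multi-index is supported on the projections of the support (for `ℕ`-valued
multi-indices the image point does lie in the support). [folklore] -/
private theorem proj_mem_support_plantFamily (L : ℕ) {d : ι → Site ν →₀ ℕ} {i : ι} {x : Site ν}
    (hx : x ∈ (d i).support) : Torus.proj L x ∈ (plantFamily L d i).support := by
  classical
  have hfun : (fun y : Site ν => (0 : TorusSite ν L) + Torus.proj L y) = Torus.proj L :=
    funext fun y => zero_add _
  unfold plantFamily plant
  rw [hfun, Finsupp.mem_support_iff, Finsupp.mapDomain, Finsupp.sum_apply]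
  apply ne_of_gt
  calc (0 : ℕ) < d i x := Nat.pos_of_ne_zero (Finsupp.mem_support_iff.1 hx)
    _ = (Finsupp.single (Torus.proj L x) (d i x) : TorusSite ν L →₀ ℕ) (Torus.proj L x) := by
        rw [Finsupp.single_eq_same]
    _ ≤ (d i).sum fun a b => (Finsupp.single (Torus.proj L a) b : TorusSite ν L →₀ ℕ)
          (Torus.proj L x) := by
        rw [Finsupp.sum]
        exact Finset.single_le_sum (f := fun a => (Finsupp.single (Torus.proj L a) (d i a) :
          TorusSite ν L →₀ ℕ) (Torus.proj L x)) (fun _ _ => Nat.zero_le _) hx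

/-- Reachability through links of `ℤ^ν` projects to reachability through the projected links of the
torus. [folklore] -/
private theorem reachable_proj [DecidableEq (TorusSite ν L × Fin ν)] (K : Finset (Site ν × Fin ν))
    {x y : Site ν} (h : (bondGraph latLinkSrc latLinkTgt (↑K : Set (Site ν × Fin ν))).Reachable x y) :
    (bondGraph linkSrc linkTgt
      (↑(K.image fun b => (Torus.proj L b.1, b.2)) : Set (TorusSite ν L × Fin ν))).Reachable
      (Torus.proj L x) (Torus.proj L y) := by
  obtain ⟨w⟩ := h
  induction w with
  | nil => exact SimpleGraph.Reachable.refl _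
  | @cons u v _ hadj _ ih =>
    refine SimpleGraph.Reachable.trans ?_ ih
    by_cases huv : Torus.proj L u = Torus.proj L v
    · rw [huv]
    · apply SimpleGraph.Adj.reachable
      rw [bondGraph, SimpleGraph.fromEdgeSet_adj] at hadj ⊢
      obtain ⟨⟨b, hb, hbe⟩, _⟩ := hadj
      refine ⟨⟨(Torus.proj L b.1, b.2), ?_, ?_⟩, huv⟩
      · exact Finset.mem_coe.2 (Finset.mem_image_of_mem _ (Finset.mem_coe.1 hb))
      · simp only [linkSrc, linkTgt]
        simp only [latLinkSrc, latLinkTgt] at hbe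
        rw [← proj_add_single]
        rcases Sym2.eq_iff.1 hbe with ⟨h1, h2⟩ | ⟨h1, h2⟩
        · rw [h2, h1]
        · rw [h2, h1, Sym2.eq_swap]

/-- A linking link set of `ℤ^ν` projects to a torus link set linking the planted family.
[cite: SalmhoferSeiler1991, Thm. 3.11 (3.32)] -/
theorem isLinking_proj [DecidableEq (TorusSite ν L × Fin ν)] {d : ι → Site ν →₀ ℕ} {S : Finset ι}
    {K : Finset (Site ν × Fin ν)} (hK : IsLinking latLinkSrc latLinkTgt (↑K : Set _) d S) :
    IsLinking linkSrc linkTgt (↑(K.image fun b => (Torus.proj L b.1, b.2)) : Set _)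
      (plantFamily L d) S := by
  intro I hI hIne hIS
  obtain ⟨i, hi, j, hj, hjI, x, hx, y, hy, hxy⟩ := hK I hI hIne hIS
  exact ⟨i, hi, j, hj, hjI, _, proj_mem_support_plantFamily L hx, _,
    proj_mem_support_plantFamily L hy, reachable_proj (L := L) K hxy⟩

/-- **`ϑ_Λ ≤ |K|` for every link set `K` of `ℤ^ν` joining the family**: the tree length of the
planted family on any torus is at most the size of any linking link set of `ℤ^ν` (project it).
[cite: SalmhoferSeiler1991, Thm. 3.11 (3.32)] -/
theorem njlTreeLength_le_card_of_isLinking (L : ℕ) {d : ι → Site ν →₀ ℕ} {S : Finset ι}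
    {K : Finset (Site ν × Fin ν)} (hK : IsLinking latLinkSrc latLinkTgt (↑K : Set _) d S) :
    njlTreeLength L d S ≤ K.card := by
  classical
  exact (steiner_le_card linkSrc linkTgt (isLinking_proj (L := L) hK)).trans Finset.card_image_le

end Projection

/-! ### Lifting: `ϑ_{ℤ^ν} ≤ ϑ_Λ` in a large volume -/

section Lifting

variable {L : ℕ}

/-- The links of `ℤ^ν` inside the box `|x|_∞ ≤ R'` lying over a torus link set `K`. [cite: SalmhoferSeiler1991, Thm. 3.11 (3.32)] -/
def liftLinks (L R' : ℕ) (K : Finset (TorusSite ν L × Fin ν)) : Finset (Site ν × Fin ν) :=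
  ((Fintype.piFinset fun _ : Fin ν => Finset.Icc (-(R' : ℤ)) R') ×ˢ Finset.univ).filter
    fun b => (Torus.proj L b.1, b.2) ∈ K

/-- Membership in the lifted link set. [cite: SalmhoferSeiler1991, Thm. 3.11 (3.32)] -/
theorem mem_liftLinks {L R' : ℕ} {K : Finset (TorusSite ν L × Fin ν)} {b : Site ν × Fin ν} :
    b ∈ liftLinks L R' K ↔ (∀ j, |b.1 j| ≤ (R' : ℤ)) ∧ (Torus.proj L b.1, b.2) ∈ K := by
  simp only [liftLinks, mem_filter, mem_product, Fintype.mem_piFinset, mem_Icc, mem_univ, and_true,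
    abs_le]

/-- The lifted link set is no larger than `K` (the projection is injective on the box).
[cite: SalmhoferSeiler1991, Thm. 3.11 (3.32)] -/
theorem card_liftLinks_le {L R' : ℕ} (hL : 2 * R' < L) (K : Finset (TorusSite ν L × Fin ν)) :
    (liftLinks L R' K).card ≤ K.card := by
  refine Finset.card_le_card_of_injOn (fun b => (Torus.proj L b.1, b.2)) (fun b hb => ?_)
    (fun b hb b' hb' h => ?_)
  · exact (mem_liftLinks.1 (Finset.mem_coe.1 hb)).2
  · have h1 := (mem_liftLinks.1 (Finset.mem_coe.1 hb)).1
    have h1' := (mem_liftLinks.1 (Finset.mem_coe.1 hb')).1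
    obtain ⟨hp, hμ⟩ := Prod.mk.inj h
    exact Prod.ext (torusProj_injOn_box hL h1 h1' hp) hμ

/-- A path in a finite link graph has at most as many steps as there are links. [folklore] -/
private theorem exists_walk_length_le (K : Finset (TorusSite ν L × Fin ν)) {u v : TorusSite ν L}
    (h : (bondGraph linkSrc linkTgt (↑K : Set _)).Reachable u v) :
    ∃ w : (bondGraph linkSrc linkTgt (↑K : Set (TorusSite ν L × Fin ν))).Walk u v,
      w.length ≤ K.card := by
  classical
  obtain ⟨p⟩ := h
  refine ⟨p.bypass, ?_⟩
  have hnd := p.bypass_isPath.isTrail.edges_nodup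
  rw [← SimpleGraph.Walk.length_edges, ← List.toFinset_card_of_nodup hnd]
  calc p.bypass.edges.toFinset.card
      ≤ (K.image fun b => s(linkSrc b, linkTgt b)).card := by
        refine Finset.card_le_card fun e he => ?_
        have he' : e ∈ (bondGraph linkSrc linkTgt (↑K : Set (TorusSite ν L × Fin ν))).edgeSet :=
          p.bypass.edges_subset_edgeSet (List.mem_toFinset.1 he)
        rw [bondGraph, SimpleGraph.edgeSet_fromEdgeSet] at he'
        obtain ⟨⟨b, hb, rfl⟩, _⟩ := he'
        exact Finset.mem_image_of_mem _ (Finset.mem_coe.1 hb)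
    _ ≤ K.card := Finset.card_image_le

/-- **Lifting a torus path into `ℤ^ν`.**  A walk of length `ℓ` in the link graph of `K` starting at
`proj x`, with `|x|_∞ + ℓ ≤ R'`, lifts to a chain of links of `ℤ^ν` inside the box `|·|_∞ ≤ R'`
lying over `K`, ending at a point `x'` over the end of the walk with `|x' - x|_∞ ≤ ℓ`. [cite: SalmhoferSeiler1991, Thm. 3.11 (3.32)] -/
private theorem lift_walk {R' : ℕ} (K : Finset (TorusSite ν L × Fin ν)) {u v : TorusSite ν L}
    (w : (bondGraph linkSrc linkTgt (↑K : Set (TorusSite ν L × Fin ν))).Walk u v) :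
    ∀ x : Site ν, Torus.proj L x = u → (∀ j, |x j| + w.length ≤ (R' : ℤ)) →
      ∃ x' : Site ν, Torus.proj L x' = v ∧ (∀ j, |x' j - x j| ≤ (w.length : ℤ)) ∧
        (bondGraph latLinkSrc latLinkTgt (↑(liftLinks L R' K) : Set _)).Reachable x x' := by
  induction w with
  | nil =>
    intro x hx _
    exact ⟨x, hx, fun j => by simp, SimpleGraph.Reachable.refl _⟩
  | @cons u u₁ v hadj w ih =>
    intro x hx hbox
    rw [bondGraph, SimpleGraph.fromEdgeSet_adj] at hadj
    obtain ⟨⟨b, hb, hbe⟩, _⟩ := hadj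
    simp only [SimpleGraph.Walk.length_cons, Nat.cast_add, Nat.cast_one] at hbox ⊢
    have habs1 : ∀ j, |(Pi.single b.2 (1 : ℤ) : Site ν) j| ≤ 1 := by
      intro j
      by_cases h : j = b.2
      · subst h; simp
      · simp [Pi.single_eq_of_ne h]
    -- the lifted neighbour `x₁` of `x` over `u₁`, and the link joining them
    obtain ⟨x₁, hx₁u, hx₁x, hx₁adj⟩ : ∃ x₁ : Site ν, Torus.proj L x₁ = u₁ ∧
        (∀ j, |x₁ j - x j| ≤ 1) ∧
        (bondGraph latLinkSrc latLinkTgt (↑(liftLinks L R' K) : Set _)).Reachable x x₁ := by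
      simp only [linkSrc, linkTgt] at hbe
      rcases Sym2.eq_iff.1 hbe with ⟨h1, h2⟩ | ⟨h1, h2⟩
      · -- `u = b.1`, `u₁ = b.1 + e_μ`: step forward along the link `(x, μ)`
        refine ⟨x + Pi.single b.2 1, ?_, fun j => ?_, ?_⟩
        · rw [proj_add_single, hx, ← h1, h2]
        · simpa using habs1 j
        · have hmem : (x, b.2) ∈ liftLinks L R' K := by
            rw [mem_liftLinks]
            refine ⟨fun j => ?_, ?_⟩
            · dsimp only
              have := hbox j
              have h0 : (0 : ℤ) ≤ w.length := Nat.cast_nonneg _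
              linarith
            · dsimp only
              rw [hx, ← h1]
              exact hb
          exact bondGraph_reachable latLinkSrc latLinkTgt (Finset.mem_coe.2 hmem)
      · -- `u = b.1 + e_μ`, `u₁ = b.1`: step backward along the link `(x - e_μ, μ)`
        have hproj : Torus.proj L (x - Pi.single b.2 1) = b.1 := by
          have h3 : Torus.proj L (x - Pi.single b.2 1) + Pi.single b.2 1 =
              b.1 + Pi.single b.2 1 := by
            rw [← proj_add_single, sub_add_cancel, hx, ← h2]
          exact add_right_cancel h3
        refine ⟨x - Pi.single b.2 1, ?_, fun j => ?_, ?_⟩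
        · rw [hproj, h1]
        · simp only [Pi.sub_apply, sub_sub_cancel_left, abs_neg]
          exact habs1 j
        · have hmem : (x - Pi.single b.2 1, b.2) ∈ liftLinks L R' K := by
            rw [mem_liftLinks]
            refine ⟨fun j => ?_, ?_⟩
            · dsimp only
              have := hbox j
              have h0 : (0 : ℤ) ≤ w.length := Nat.cast_nonneg _
              have h3 : |(x - Pi.single b.2 (1 : ℤ) : Site ν) j| ≤ |x j| + 1 := by
                rw [Pi.sub_apply]
                exact (abs_sub _ _).trans (by linarith [habs1 j])
              linarith
            · dsimp only
              rw [hproj]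
              exact hb
          have hr := bondGraph_reachable latLinkSrc latLinkTgt (Finset.mem_coe.2 hmem)
          simp only [latLinkSrc, latLinkTgt, sub_add_cancel] at hr
          exact hr.symm
    -- continue along the rest of the walk
    obtain ⟨x', hx'v, hx'x₁, hreach⟩ := ih x₁ hx₁u fun j => by
      have := hbox j
      have h3 : |x₁ j| ≤ |x j| + 1 := by
        have := hx₁x j
        have := abs_sub_abs_le_abs_sub (x₁ j) (x j)
        linarith
      linarith
    refine ⟨x', hx'v, fun j => ?_, hx₁adj.trans hreach⟩
    have h4 : |x' j - x j| ≤ |x' j - x₁ j| + |x₁ j - x j| := abs_sub_le _ _ _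
    linarith [hx'x₁ j, hx₁x j]

/-- **Lifting a linking set.**  If the observables are supported in the box `|x|_∞ ≤ R` and a torus
link set `K` with `2(R + |K|) < L` links the planted family, then the links of `ℤ^ν` over `K` inside
the box `|x|_∞ ≤ R + |K|` link the original family. [cite: SalmhoferSeiler1991, Thm. 3.11 (3.32)] -/
theorem isLinking_liftLinks {d : ι → Site ν →₀ ℕ} {S : Finset ι} {R : ℕ}
    (hbox : ∀ i ∈ S, ∀ x ∈ (d i).support, ∀ j, |x j| ≤ (R : ℤ))
    {K : Finset (TorusSite ν L × Fin ν)} (hL : 2 * (R + K.card) < L)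
    (hK : IsLinking linkSrc linkTgt (↑K : Set _) (plantFamily L d) S) :
    IsLinking latLinkSrc latLinkTgt (↑(liftLinks L (R + K.card) K) : Set _) d S := by
  classical
  intro I hI hIne hIS
  obtain ⟨i, hi, j, hj, hjI, p, hp, q, hq, hpq⟩ := hK I hI hIne hIS
  -- the planted supports are projections of the original supports
  obtain ⟨x, hx, rfl⟩ : ∃ x ∈ (d i).support, (0 : TorusSite ν L) + Torus.proj L x = p := by
    unfold plantFamily plant at hp
    simpa using Finsupp.mapDomain_support hp
  obtain ⟨y, hy, rfl⟩ : ∃ y ∈ (d j).support, (0 : TorusSite ν L) + Torus.proj L y = q := by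
    unfold plantFamily plant at hq
    simpa using Finsupp.mapDomain_support hq
  rw [zero_add, zero_add] at hpq
  obtain ⟨w, hw⟩ := exists_walk_length_le K hpq
  obtain ⟨x', hx'q, hx'x, hreach⟩ := lift_walk (R' := R + K.card) K w x rfl fun k => by
    have := hbox i (hI hi) x hx k
    push_cast
    have : (w.length : ℤ) ≤ K.card := by exact_mod_cast hw
    linarith
  -- the end point of the lift is `y` itself, by injectivity of the projection on the big box
  have hx'box : ∀ k, |x' k| ≤ ((R + K.card : ℕ) : ℤ) := fun k => by
    have h1 := hx'x k
    have h2 := hbox i (hI hi) x hx k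
    have h3 : |x' k| ≤ |x' k - x k| + |x k| := by
      have := abs_add_le (x' k - x k) (x k); rwa [sub_add_cancel] at this
    have : (w.length : ℤ) ≤ K.card := by exact_mod_cast hw
    push_cast; linarith
  have hybox : ∀ k, |y k| ≤ ((R + K.card : ℕ) : ℤ) := fun k => by
    have := hbox j hj y hy k; push_cast; linarith
  have hxy : x' = y := torusProj_injOn_box hL hx'box hybox hx'q
  subst hxy
  exact ⟨i, hi, j, hj, hjI, x, hx, x', hy, hreach⟩

/-- **`ϑ_{ℤ^ν} ≤ ϑ_Λ` in a large volume**: if the observables are supported in `|x|_∞ ≤ R` and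
`2(R + ϑ_{ℤ^ν}) < L`, the tree length of the planted family on the torus `(ℤ/Lℤ)^ν` is at least the
tree length on `ℤ^ν`. [cite: SalmhoferSeiler1991, Thm. 3.11 (3.32)] -/
theorem latTreeLength_le_njlTreeLength {d : ι → Site ν →₀ ℕ} {S : Finset ι} {R : ℕ}
    (hbox : ∀ i ∈ S, ∀ x ∈ (d i).support, ∀ j, |x j| ≤ (R : ℤ))
    (hL : 2 * (R + latTreeLength d S) < L) :
    latTreeLength d S ≤ njlTreeLength L d S := by
  classical
  by_contra hlt
  rw [not_le] at hlt
  -- the torus Steiner set is attained (the ℤ^ν one is positive, hence both families are nonempty)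
  have hZne : {n : ℕ | ∃ K : Finset (Site ν × Fin ν), K.card = n ∧
      IsLinking latLinkSrc latLinkTgt (↑K : Set _) d S}.Nonempty := by
    by_contra h
    have h0 : latTreeLength d S = 0 := by
      unfold latTreeLength steiner
      rw [Set.not_nonempty_iff_eq_empty.1 h, Nat.sInf_empty]
    omega
  obtain ⟨_, KZ, _, hKZ⟩ := hZne
  have htne : {n : ℕ | ∃ K : Finset (TorusSite ν L × Fin ν), K.card = n ∧
      IsLinking linkSrc linkTgt (↑K : Set _) (plantFamily L d) S}.Nonempty :=
    ⟨_, _, rfl, isLinking_proj (L := L) hKZ⟩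
  obtain ⟨K, hKcard, hK⟩ := Nat.sInf_mem htne
  have hKlt : K.card < latTreeLength d S := by
    rw [hKcard]; exact hlt
  have hL' : 2 * (R + K.card) < L := by omega
  have hlift := isLinking_liftLinks hbox hL' hK
  have h1 : latTreeLength d S ≤ (liftLinks L (R + K.card) K).card :=
    steiner_le_card latLinkSrc latLinkTgt hlift
  have h2 : (liftLinks L (R + K.card) K).card ≤ K.card :=
    card_liftLinks_le (by omega) K
  omega

end Lifting

/-! ### Theorem 3.11 with the tree length of `ℤ^ν` -/

section Printed

variable [LinearOrder ι] {N : ℕ}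

/-- **Theorem 3.11, every `n`, tree length on `ℤ^ν`, every large volume — Joukowski form.**  For the
NJL system (`N ≥ 1` colours, `ν ≥ 1`), a nonempty family of local monomial observables `σ^{L_i}`
(`i ∈ S`) supported in `|x|_∞ ≤ R` with `∑ L_i ≤ N`, every volume `(ℤ/Lℤ)^ν` with
`2(R + ϑ) < L`, every `r < 1` and `0 < |w| < r`, at `m = (√(2ν)/2)(w⁻¹ - w)`:
`|⟨σ^{L_1}; …; σ^{L_n}⟩^T_Λ(m)| ≤ 2^{n²} A(r)^{|L|} (|w|/r)^{|L| + 2ϑ(L_1,…,L_n)}`, `ϑ` the tree length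
on `ℤ^ν`. [cite: SalmhoferSeiler1991, Thm. 3.11 (3.32)][cite: SalmhoferSeiler1992Erratum, (1)–(2)] -/
theorem njl_truncated_clustering_lat (hN : 1 ≤ N) (hν : 1 ≤ ν) {L : ℕ} [NeZero L]
    {d : ι → Site ν →₀ ℕ} {S : Finset ι} {R : ℕ} (hL : 2 * (R + latTreeLength d S) < L)
    (hbox : ∀ i ∈ S, ∀ x ∈ (d i).support, ∀ j, |x j| ≤ (R : ℤ))
    (hdN : ∀ x, (∑ i ∈ S, d i) x ≤ N) (hS : S.Nonempty)
    {r : ℝ} (hr : r < 1) {w : ℂ} (hw0 : w ≠ 0) (hw : ‖w‖ < r) :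
    ‖njlTruncated N L d S (joukowskiMass (Real.sqrt (2 * ν)) w)‖ ≤
      2 ^ (S.card ^ 2) * njlSpinMajorant ν r ^ (∑ i ∈ S, (d i).degree) *
        (‖w‖ / r) ^ (∑ i ∈ S, (d i).degree + 2 * latTreeLength d S) := by
  have hL2 : 2 * R < L := by omega
  have hρ : 0 < ‖w‖ := norm_pos_iff.2 hw0
  have hr0 : 0 < r := hρ.trans hw
  have hq1 : ‖w‖ / r ≤ 1 := (div_le_one hr0).2 hw.le
  refine (njl_truncated_clustering_joukowskiMass hN hν hL2 hbox hdN hS hr hw0 hw).trans ?_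
  apply mul_le_mul_of_nonneg_left _
    (mul_nonneg (by positivity) (pow_nonneg (njlSpinMajorant_nonneg ν r) _))
  apply pow_le_pow_of_le_one (div_pos hρ hr0).le hq1
  have := latTreeLength_le_njlTreeLength (L := L) hbox hL
  omega

/-- **(3.32) verbatim — single sites.**  For points `x_1, …, x_n ∈ ℤ^ν` (`i ∈ S`, repetitions
allowed up to multiplicity `N` per site) in the box `|x|_∞ ≤ R`, every volume with `2(R + ϑ) < L`,
`r < 1`, `0 < |w| < r`, `m = (√(2ν)/2)(w⁻¹ - w)`:
`|⟨σ_{x_1}; …; σ_{x_n}⟩^T_Λ(m)| ≤ 2^{n²} A(r)^n (|w|/r)^{n + 2ϑ(x_1,…,x_n)}`, with `ϑ(x_1,…,x_n)` the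
length of a minimal tree of links of `ℤ^ν` connecting the points. [cite: SalmhoferSeiler1991, Thm. 3.11 (3.32)][cite: SalmhoferSeiler1992Erratum, (1)–(2)] -/
theorem njl_nPoint_truncated_clustering (hN : 1 ≤ N) (hν : 1 ≤ ν) {L : ℕ} [NeZero L]
    {x : ι → Site ν} {S : Finset ι} {R : ℕ}
    (hL : 2 * (R + latTreeLength (fun i => Finsupp.single (x i) 1) S) < L)
    (hbox : ∀ i ∈ S, ∀ j, |x i j| ≤ (R : ℤ))
    (hxN : ∀ z, (∑ i ∈ S, Finsupp.single (x i) 1) z ≤ N) (hS : S.Nonempty)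
    {r : ℝ} (hr : r < 1) {w : ℂ} (hw0 : w ≠ 0) (hw : ‖w‖ < r) :
    ‖njlTruncated N L (fun i => Finsupp.single (x i) 1) S (joukowskiMass (Real.sqrt (2 * ν)) w)‖ ≤
      2 ^ (S.card ^ 2) * njlSpinMajorant ν r ^ S.card *
        (‖w‖ / r) ^ (S.card + 2 * latTreeLength (fun i => Finsupp.single (x i) 1) S) := by
  have hdeg : ∑ i ∈ S, (Finsupp.single (x i) 1 : Site ν →₀ ℕ).degree = S.card := by
    simp [Finsupp.degree_single]
  have h := njl_truncated_clustering_lat hN hν hL (fun i hi z hz j => by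
    obtain ⟨rfl, -⟩ := Finsupp.mem_support_single _ _ _ |>.1 hz
    exact hbox i hi j) hxN hS hr hw0 hw
  rwa [hdeg] at h

/-- `(q/r)^{2D} = exp(-κ D)` with `κ = 2 log(r/q)`. [folklore] -/
private theorem pow_eq_exp_neg'' {q r : ℝ} (hq : 0 < q) (hr : 0 < r) (D : ℕ) :
    (q / r) ^ (2 * D) = Real.exp (-(2 * Real.log (r / q)) * D) := by
  have hqr : 0 < q / r := div_pos hq hr
  rw [← Real.exp_log (pow_pos hqr (2 * D)), Real.log_pow, Real.log_div hq.ne' hr.ne',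
    Real.log_div hr.ne' hq.ne']
  congr 1
  push_cast
  ring

/-- **Theorem 3.11 with the Erratum, exponential form, tree length on `ℤ^ν`**: for every `m` off
`i[-√(2ν), √(2ν)]` there are ONE rate `κ(m) > 0` (independent of `n`, Remark 3.12) and `A(m) ≥ 0`
with `|⟨σ^{L_1}; …; σ^{L_n}⟩^T_Λ(m)| ≤ 2^{n²} A^{|L|} e^{-κ(m) ϑ(L_1,…,L_n)}` for every `n`, every
admissible family (supports in `|x|_∞ ≤ R`, `∑ L_i ≤ N`) and every volume `(ℤ/Lℤ)^ν` with
`2(R + ϑ) < L`. [cite: SalmhoferSeiler1991, Thm. 3.11 (3.32) and Remark 3.12][cite: SalmhoferSeiler1992Erratum, (1)–(2)] -/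
theorem njl_truncated_exponentialClustering_lat (hN : 1 ≤ N) (hν : 1 ≤ ν) {m : ℂ}
    (hm : m ∈ njlMassRegion ν) :
    ∃ κ : ℝ, 0 < κ ∧ ∃ A : ℝ, 0 ≤ A ∧
      ∀ (L : ℕ) [NeZero L] (n : ℕ) (d : Fin n → Site ν →₀ ℕ) (S : Finset (Fin n)) (R : ℕ),
        2 * (R + latTreeLength d S) < L → (∀ i ∈ S, ∀ x ∈ (d i).support, ∀ j, |x j| ≤ (R : ℤ)) →
        (∀ x, (∑ i ∈ S, d i) x ≤ N) → S.Nonempty →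
        ‖njlTruncated N L d S m‖ ≤
          2 ^ (S.card ^ 2) * A ^ (∑ i ∈ S, (d i).degree) *
            Real.exp (-κ * latTreeLength d S) := by
  have hνpos : (0 : ℝ) < ν := by exact_mod_cast Nat.lt_of_lt_of_le Nat.zero_lt_one hν
  have hs0 : 0 < Real.sqrt (2 * (ν : ℝ)) := Real.sqrt_pos.2 (by positivity)
  obtain ⟨w, hw0, hw1, hwm⟩ := exists_joukowskiMass_eq hs0 hm
  set q : ℝ := ‖w‖ with hq
  have hq0 : 0 < q := norm_pos_iff.2 hw0
  set r : ℝ := (q + 1) / 2 with hr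
  have hqr : q < r := by rw [hr]; linarith
  have hr1 : r < 1 := by rw [hr]; linarith
  have hr0 : 0 < r := hq0.trans hqr
  have hqr1 : q / r ≤ 1 := (div_le_one hr0).2 hqr.le
  refine ⟨2 * Real.log (r / q), ?_, njlSpinMajorant ν r, njlSpinMajorant_nonneg ν r,
    fun L _ n d S R hL hbox hdN hS => ?_⟩
  · have : 1 < r / q := by rw [lt_div_iff₀ hq0]; linarith
    have := Real.log_pos this
    positivity
  · rw [← hwm]
    refine (njl_truncated_clustering_lat hN hν hL hbox hdN hS hr1 hw0 hqr).trans ?_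
    apply mul_le_mul_of_nonneg_left _
      (mul_nonneg (by positivity) (pow_nonneg (njlSpinMajorant_nonneg ν r) _))
    calc (q / r) ^ (∑ i ∈ S, (d i).degree + 2 * latTreeLength d S)
        ≤ (q / r) ^ (2 * latTreeLength d S) :=
          pow_le_pow_of_le_one (div_pos hq0 hr0).le hqr1 (Nat.le_add_left _ _)
      _ = Real.exp (-(2 * Real.log (r / q)) * ↑(latTreeLength d S)) := pow_eq_exp_neg'' hq0 hr0 _

/-- **Theorem 3.11 for the thermodynamic limit (the infinite-volume NJL state of Thm. 3.8).**  For
every `m` off `i[-√(2ν), √(2ν)]` there are `κ(m) > 0` (one rate for all `n`) and `A(m) ≥ 0` such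
that for every `n`, every admissible family `σ^{L_1}, …, σ^{L_n}` and every sequence of tori
`L_j → ∞` along which the correlation functions of all sub-families converge (they do, for every
sequence — `njl_thermodynamicLimit`), the truncated function of the limits obeys
`|⟨σ^{L_1}; …; σ^{L_n}⟩^T(m)| ≤ 2^{n²} A^{|L|} e^{-κ(m) ϑ(L_1,…,L_n)}`, `ϑ` the tree length on `ℤ^ν`
— (3.32)/(1) as printed, for the infinite-volume state. [cite: SalmhoferSeiler1991, Thm. 3.11 (3.32) and Thm. 3.8][cite: SalmhoferSeiler1992Erratum, (1)–(2)] -/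
theorem njl_truncated_exponentialClustering_limit (hN : 1 ≤ N) (hν : 1 ≤ ν) {m : ℂ}
    (hm : m ∈ njlMassRegion ν) :
    ∃ κ : ℝ, 0 < κ ∧ ∃ A : ℝ, 0 ≤ A ∧
      ∀ (n : ℕ) (d : Fin n → Site ν →₀ ℕ) (S : Finset (Fin n)) (R : ℕ),
        (∀ i ∈ S, ∀ x ∈ (d i).support, ∀ j, |x j| ≤ (R : ℤ)) →
        (∀ x, (∑ i ∈ S, d i) x ≤ N) → S.Nonempty →
        ∀ (Ls : ℕ → ℕ) [∀ j, NeZero (Ls j)], Tendsto Ls atTop atTop →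
        ∀ E : Finset (Fin n) → ℂ,
          (∀ B ⊆ S, Tendsto (fun j => njlCorrelation N (Ls j) (∑ i ∈ B, d i) m) atTop (𝓝 (E B))) →
          ‖Ursell.ursell E S‖ ≤
            2 ^ (S.card ^ 2) * A ^ (∑ i ∈ S, (d i).degree) * Real.exp (-κ * latTreeLength d S) := by
  obtain ⟨κ, hκ, A, hA, h⟩ := njl_truncated_exponentialClustering_lat hN hν hm
  refine ⟨κ, hκ, A, hA, fun n d S R hbox hdN hS Ls _ hLs E hE => ?_⟩
  have hlim : Tendsto (fun j => njlTruncated N (Ls j) d S m) atTop (𝓝 (Ursell.ursell E S)) :=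
    Ursell.tendsto_ursell hE
  have hev : ∀ᶠ j in atTop, ‖njlTruncated N (Ls j) d S m‖ ≤
      2 ^ (S.card ^ 2) * A ^ (∑ i ∈ S, (d i).degree) * Real.exp (-κ * latTreeLength d S) := by
    filter_upwards [hLs.eventually (eventually_gt_atTop (2 * (R + latTreeLength d S)))] with j hj
    exact h (Ls j) n d S R hj hbox hdN hS
  exact le_of_tendsto ((continuous_norm.tendsto _).comp hlim) hev

end Printed

end ComplexSpin

end Literature.MathematicalPhysics.StatisticalMechanics
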